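import Mathlib
import Summits.BirchSwinnertonDyer.BirchSwinnertonDyer.Theorems.ResidualThetaTransportAtTwoSignedMuSeedAtTwoPlusNonsquareDescentFreeness
import Summits.BirchSwinnertonDyer.BirchSwinnertonDyer.Theorems.ResidualThetaTransportAtTwoSignedMuSeedAtTwoPlusNonsquareDescentEngine
import Summits.BirchSwinnertonDyer.BirchSwinnertonDyer.Theorems.ResidualThetaTransportAtTwoSignedMuSeedAtTwoPlusNonsquareDescentTowerNorms
import HarnessLib

/-!
# Non-square descent — ASSEMBLY of stub S2 («`Q'[ω_n] = 0` from freeness + exact norm relations + finite layers, with NO local input»)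
# for the seed crux `SignedMuSeedAtTwoPlus` stmt-BirchSwinnertonDyer-21438 (parent Kμ⁺ `SignedMuVanishingAtTwoPlus` stmt-BirchSwinnertonDyer-20689,
# route ResidualThetaTransportAtTwo)

Cell `bsd-wall`, width seat `bsd-wall-rtt-p4-w2` g17 (`--supports`, closes nothing).  THEOREMS ONLY; BSD is not proved by this; nothing
arithmetic is asserted.  This file COMPOSES the freeness descent (`Theorems/…NonsquareDescentFreeness.lean`), the coherent-vanishing
engine (`Theorems/…NonsquareDescentEngine.lean`) and the norm-element identities (`Theorems/…NonsquareDescentTowerNorms.lean`) into the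
single module-theoretic statement behind stub S2 of `Cruxes/SignedMuSeedAtTwoPlus/Lines/nonsquare-descent.md`:

> because `𝓒'_m = 𝒪[G_m]u_m` is free with EXACT norm relations `N_{m,n} u_m = u_n`, the quotients `B'_m = 𝓔_m^χ/𝓒'_m` descend perfectly
> (`(B'_m)^{G_{m,n}} = B'_n`, `H¹(G, 𝓒'_m) = 0`), which forces `Q' = lim B'_m` to have `Q'[ω_n] = 0` for every `n` — hence characteristic
> series prime to every `ω_n` — WITHOUT any local (Coleman / `2`-adic `L`) input.

§1 `limit_torsionBy_eq_bot` — ABSTRACT TOWER.  Data over a commutative ring `R` (`Λ'`): level elements `ω k` and one-step norm elements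
`ν k` with `ω (k+1) = ν k · ω k`, `ω k ∣ ν k − c` (`c` = the index `p`), `ω n ∣ ω k` (`n ≤ k`), `ω k`, `ν k` non-zero-divisors; level modules
`E k` (`𝓔_k^χ`) killed by `ω k`; injective `j k : E k → E (k+1)` with range the `ω k`-torsion (Galois descent for units); `Nm k : E (k+1) → E k`
with `j k ∘ Nm k = ν k •` (the norm); `u k ∈ E k` with annihilator EXACTLY `(ω k)` (S1: `𝒪[G_k]u_k` free of rank one) and `Nm k (u (k+1)) = u k`
(S1: exact norm relation); every `B_k = E k ⧸ R∙u k` killed by a power of `c` (finite `2`-groups).  Conclusion: for every `R`-module `Q` with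
projections `π k : Q → B_k` compatible with the induced norms and jointly injective (the inverse limit `Q' = lim B_k`), **`Q[ω n] = 0` for
every `n`**.  (`norm_comp_incl_eq_smul`: norm after inclusion is multiplication by `c` on a level killed by `ω k`.)

§2 `limit_torsionBy_eq_bot_of_generator` — THE CYCLOTOMIC MODEL `ω k = γ^{p^k} − 1`, `ν k = ∑_{i<p} γ^{p^k i}`, `c = p`: the three ring
identities are discharged (`pow_mul_sub_one_eq_geom_sum_mul`, `sub_one_dvd_geom_sum_sub_natCast`, `pow_one_sub_dvd_pow_mul_sub_one`), leaving
only the non-zero-divisor hypotheses; §3 discharges those in `𝒪⟦X⟧` with `γ = 1 + X` for a domain `𝒪` in which `p ≠ 0`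
(`geom_sum_one_add_X_pow_ne_zero`, `one_add_X_pow_sub_one_ne_zero`, `…_mem_nonZeroDivisors`).

§4 (appended) `coherent_family_eq_zero` — the FAMILY form of §1 (no inverse-limit object `Q`, no `hsep`/`hπ`): every norm-coherent family
`z k ∈ E k ⧸ R∙u k` with `ω n • z k = 0` for all `k` is identically zero.

[folklore]
-/

set_option autoImplicit false
-- the Theorems namespace of this sub repeats the summit name by design (D-0017 nested layout)
set_option linter.dupNamespace false

open scoped nonZeroDivisors
open Finset

namespace Summit.BirchSwinnertonDyer.BirchSwinnertonDyer.Theorems.SignedMuAtTwo.NonsquareDescent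

/-! ## §1 The abstract tower -/

section Assembly

variable {R : Type*} [CommRing R]
variable (E : ℕ → Type*) [∀ k, AddCommGroup (E k)] [∀ k, Module R (E k)]

/-- **Norm after inclusion is the index.**  If `ω k ∣ ν k − c`, the level `E k` is killed by `ω k`, `j` is injective and `j ∘ Nm = ν k •`,
then `Nm (j e) = c • e`. [folklore] -/
theorem norm_comp_incl_eq_smul (ω ν : ℕ → R) (c : R) (k : ℕ) (hνc : ω k ∣ ν k - c)
    (hE : ∀ x : E k, ω k • x = 0) (j : E k →ₗ[R] E (k + 1)) (hj : Function.Injective j)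
    (Nm : E (k + 1) →ₗ[R] E k) (hNm : ∀ x : E (k + 1), j (Nm x) = ν k • x) (e : E k) :
    Nm (j e) = c • e := by
  apply hj
  have hν : ν k • e = c • e := by
    obtain ⟨r, hr⟩ := hνc
    have h1 : ν k = c + ω k * r := by rw [← hr]; ring
    rw [h1, add_smul, mul_comm, mul_smul, hE, smul_zero, add_zero]
  rw [hNm, ← map_smul, hν]

/-- **Stub S2, module-theoretic form: `Q'[ω_n] = 0` for every `n`.**  See the file docstring for the dictionary; the hypotheses are
exactly: tower identities for `ω`, `ν`, `c`; levels killed by `ω k`; Galois descent `E (k+1)[ω k] = j(E k)`; the norm `j ∘ Nm = ν •`;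
S1 (annihilator of `u k` is exactly `(ω k)`, `Nm (u (k+1)) = u k`); the quotients `E k ⧸ R∙u k` are `c`-power torsion; `Q` is the
inverse limit of the quotients along the induced norms.  No local input. [folklore] -/
theorem limit_torsionBy_eq_bot
    (ω ν : ℕ → R) (c : R)
    (hω0 : ∀ k, ω k ∈ R⁰) (hν0 : ∀ k, ν k ∈ R⁰)
    (hων : ∀ k, ω (k + 1) = ν k * ω k)
    (hνc : ∀ k, ω k ∣ ν k - c)
    (hdiv : ∀ n k, n ≤ k → ω n ∣ ω k)
    (hE : ∀ k (x : E k), ω k • x = 0)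
    (j : ∀ k, E k →ₗ[R] E (k + 1)) (hj : ∀ k, Function.Injective (j k))
    (hjr : ∀ k (x : E (k + 1)), ω k • x = 0 → x ∈ LinearMap.range (j k))
    (Nm : ∀ k, E (k + 1) →ₗ[R] E k) (hNm : ∀ k (x : E (k + 1)), j k (Nm k x) = ν k • x)
    (u : ∀ k, E k) (hu : ∀ k (r : R), r • u k = 0 → ω k ∣ r)
    (hNu : ∀ k, Nm k (u (k + 1)) = u k)
    (hjle : ∀ k, Submodule.span R {u k} ≤ (Submodule.span R {u (k + 1)}).comap (j k))
    (hNle : ∀ k, Submodule.span R {u (k + 1)} ≤ (Submodule.span R {u k}).comap (Nm k))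
    (htors : ∀ k, ∃ e : ℕ, ∀ y : E k ⧸ Submodule.span R {u k}, c ^ e • y = 0)
    {Q : Type*} [AddCommGroup Q] [Module R Q]
    (π : ∀ k, Q →ₗ[R] (E k ⧸ Submodule.span R {u k}))
    (hπ : ∀ k (q : Q),
      Submodule.mapQ (Submodule.span R {u (k + 1)}) (Submodule.span R {u k}) (Nm k) (hNle k) (π (k + 1) q)
        = π k q)
    (hsep : ∀ q : Q, (∀ k, π k q = 0) → q = 0)
    (n : ℕ) : Submodule.torsionBy R Q (ω n) = ⊥ := by
  have hun : ∀ k, j k (u k) = ν k • u (k + 1) := fun k => by rw [← hNu k, hNm]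
  have hu' : ∀ k (r : R), r • u (k + 1) = 0 → ν k * ω k ∣ r := fun k r hr => by
    rw [← hων]; exact hu (k + 1) r hr
  have hjω : ∀ k (x : E k), ω k • j k x = 0 := fun k x => by rw [← map_smul, hE, map_zero]
  have hE' : ∀ k (x : E (k + 1)), (ν k * ω k) • x = 0 := fun k x => by
    rw [← hων]; exact hE (k + 1) x
  refine torsionBy_eq_bot_of_coherent (fun k => E k ⧸ Submodule.span R {u k}) c (ω n) n
    (fun k => Submodule.mapQ _ _ (j k) (hjle k))
    (fun k => mapQ_injective_of_norm (hω0 k) (hu' k) (j k) (hj k) (hjω k) (hun k) (hjle k))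
    (fun k => Submodule.mapQ _ _ (Nm k) (hNle k)) ?_ ?_ htors π hπ hsep
  · intro k y
    obtain ⟨e, rfl⟩ := Submodule.mkQ_surjective _ y
    rw [Submodule.mkQ_apply, Submodule.mapQ_apply, Submodule.mapQ_apply,
      norm_comp_incl_eq_smul E ω ν c k (hνc k) (hE k) (j k) (hj k) (Nm k) (hNm k) e,
      Submodule.Quotient.mk_smul]
  · intro k hk z hz
    rw [range_mapQ_eq_torsionBy_of_norm (hν0 k) (hE' k) (hu' k) (j k) (hjω k) (hjr k) (hjle k),
      Submodule.mem_torsionBy_iff]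
    obtain ⟨r, hr⟩ := hdiv n k hk
    rw [hr, mul_comm, mul_smul, hz, smul_zero]

/-- The two `≤ comap` side conditions of `limit_torsionBy_eq_bot` hold under its other hypotheses (recorded so that a consumer can
discharge them by `exact`): `R∙u k ≤ j⁻¹(R∙u (k+1))` from `j (u k) = ν k • u (k+1)`. [folklore] -/
theorem span_le_comap_incl (ν : ℕ → R) (j : ∀ k, E k →ₗ[R] E (k + 1)) (Nm : ∀ k, E (k + 1) →ₗ[R] E k)
    (hNm : ∀ k (x : E (k + 1)), j k (Nm k x) = ν k • x) (u : ∀ k, E k) (hNu : ∀ k, Nm k (u (k + 1)) = u k)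
    (k : ℕ) : Submodule.span R {u k} ≤ (Submodule.span R {u (k + 1)}).comap (j k) :=
  span_singleton_le_comap_of_eq_smul (j k) (by rw [← hNu k, hNm])

/-- … and `R∙u (k+1) ≤ Nm⁻¹(R∙u k)` from `Nm (u (k+1)) = u k`. [folklore] -/
theorem span_le_comap_norm (Nm : ∀ k, E (k + 1) →ₗ[R] E k) (u : ∀ k, E k)
    (hNu : ∀ k, Nm k (u (k + 1)) = u k) (k : ℕ) :
    Submodule.span R {u (k + 1)} ≤ (Submodule.span R {u k}).comap (Nm k) :=
  span_singleton_le_comap_of_eq_smul (ν := (1 : R)) (Nm k) (by rw [hNu k, one_smul])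

end Assembly

/-! ## §2 The cyclotomic model `ω_k = γ^{p^k} − 1`, `ν_k = ∑_{i<p} γ^{p^k i}`, `c = p` -/

section Model

variable {R : Type*} [CommRing R]
variable (E : ℕ → Type*) [∀ k, AddCommGroup (E k)] [∀ k, Module R (E k)]

/-- `ω_n ∣ ω_k` for `n ≤ k` in the cyclotomic model. [folklore] -/
theorem pow_pow_sub_one_dvd_of_le (γ : R) (p : ℕ) {n k : ℕ} (hk : n ≤ k) :
    γ ^ p ^ n - 1 ∣ γ ^ p ^ k - 1 := by
  have hpk : p ^ k = p ^ n * p ^ (k - n) := by rw [← pow_add, Nat.add_sub_cancel' hk]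
  rw [hpk]
  exact pow_one_sub_dvd_pow_mul_sub_one γ (p ^ n) (p ^ (k - n))

/-- **Stub S2 in the cyclotomic model.**  `limit_torsionBy_eq_bot` with `ω k = γ^{p^k} − 1`, `ν k = ∑_{i<p} γ^{p^k i}` and `c = p`: the
identities `ω (k+1) = ν k ω k`, `ω k ∣ ν k − p`, `ω n ∣ ω k` are theorems, so only the non-zero-divisor hypotheses on `γ^{p^k} − 1` and
`ν k` remain (discharged in `𝒪⟦X⟧` in §3). [folklore] -/
theorem limit_torsionBy_eq_bot_of_generator (γ : R) (p : ℕ)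
    (hω0 : ∀ k, γ ^ p ^ k - 1 ∈ R⁰) (hν0 : ∀ k, (∑ i ∈ range p, γ ^ (p ^ k * i)) ∈ R⁰)
    (hE : ∀ k (x : E k), (γ ^ p ^ k - 1) • x = 0)
    (j : ∀ k, E k →ₗ[R] E (k + 1)) (hj : ∀ k, Function.Injective (j k))
    (hjr : ∀ k (x : E (k + 1)), (γ ^ p ^ k - 1) • x = 0 → x ∈ LinearMap.range (j k))
    (Nm : ∀ k, E (k + 1) →ₗ[R] E k)
    (hNm : ∀ k (x : E (k + 1)), j k (Nm k x) = (∑ i ∈ range p, γ ^ (p ^ k * i)) • x)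
    (u : ∀ k, E k) (hu : ∀ k (r : R), r • u k = 0 → γ ^ p ^ k - 1 ∣ r)
    (hNu : ∀ k, Nm k (u (k + 1)) = u k)
    (hjle : ∀ k, Submodule.span R {u k} ≤ (Submodule.span R {u (k + 1)}).comap (j k))
    (hNle : ∀ k, Submodule.span R {u (k + 1)} ≤ (Submodule.span R {u k}).comap (Nm k))
    (htors : ∀ k, ∃ e : ℕ, ∀ y : E k ⧸ Submodule.span R {u k}, (p : R) ^ e • y = 0)
    {Q : Type*} [AddCommGroup Q] [Module R Q]
    (π : ∀ k, Q →ₗ[R] (E k ⧸ Submodule.span R {u k}))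
    (hπ : ∀ k (q : Q),
      Submodule.mapQ (Submodule.span R {u (k + 1)}) (Submodule.span R {u k}) (Nm k) (hNle k) (π (k + 1) q)
        = π k q)
    (hsep : ∀ q : Q, (∀ k, π k q = 0) → q = 0)
    (n : ℕ) : Submodule.torsionBy R Q (γ ^ p ^ n - 1) = ⊥ := by
  refine limit_torsionBy_eq_bot E (fun k => γ ^ p ^ k - 1) (fun k => ∑ i ∈ range p, γ ^ (p ^ k * i)) (p : R)
    hω0 hν0 ?_ ?_ ?_ hE j hj hjr Nm hNm u hu hNu hjle hNle htors π hπ hsep n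
  · intro k
    rw [pow_succ, pow_mul_sub_one_eq_geom_sum_mul]
  · intro k
    exact sub_one_dvd_geom_sum_sub_natCast γ (p ^ k) p
  · intro n' k hk
    exact pow_pow_sub_one_dvd_of_le γ p hk

end Model

/-! ## §3 The non-zero-divisor hypotheses in `𝒪⟦X⟧` with `γ = 1 + X` -/

section PowerSeriesModel

variable {𝒪 : Type*} [CommRing 𝒪]

/-- The constant coefficient of the norm element `∑_{i<c} (1+X)^{q i}` is the number of terms `c`. [folklore] -/
theorem constantCoeff_geom_sum_one_add_X_pow (q c : ℕ) :
    PowerSeries.constantCoeff (∑ i ∈ range c, ((1 : PowerSeries 𝒪) + PowerSeries.X) ^ (q * i)) = (c : 𝒪) := by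
  rw [map_sum]
  simp [map_pow, map_add, PowerSeries.constantCoeff_X]

/-- The norm element `∑_{i<c} (1+X)^{q i}` of `𝒪⟦X⟧` is non-zero as soon as `c ≠ 0` in `𝒪`. [folklore] -/
theorem geom_sum_one_add_X_pow_ne_zero {q c : ℕ} (hc : (c : 𝒪) ≠ 0) :
    (∑ i ∈ range c, ((1 : PowerSeries 𝒪) + PowerSeries.X) ^ (q * i)) ≠ 0 := by
  intro h
  apply hc
  rw [← constantCoeff_geom_sum_one_add_X_pow (𝒪 := 𝒪) q c, h, map_zero]

/-- The level element `(1+X)^q − 1` of `𝒪⟦X⟧` is non-zero as soon as `q ≠ 0` in `𝒪` (for a domain `𝒪`): it is `X · ∑_{i<q}(1+X)^i`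
and the second factor has constant coefficient `q`. [folklore] -/
theorem one_add_X_pow_sub_one_ne_zero [IsDomain 𝒪] {q : ℕ} (hq : (q : 𝒪) ≠ 0) :
    ((1 : PowerSeries 𝒪) + PowerSeries.X) ^ q - 1 ≠ 0 := by
  have h := pow_mul_sub_one_eq_geom_sum_mul ((1 : PowerSeries 𝒪) + PowerSeries.X) 1 q
  rw [one_mul, pow_one, add_sub_cancel_left] at h
  rw [h]
  exact mul_ne_zero (geom_sum_one_add_X_pow_ne_zero (q := 1) hq) PowerSeries.X_ne_zero

/-- `ω_k = (1+X)^{p^k} − 1` is a non-zero-divisor of `𝒪⟦X⟧` (`𝒪` a domain with `p ≠ 0`). [folklore] -/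
theorem one_add_X_pow_pow_sub_one_mem_nonZeroDivisors [IsDomain 𝒪] {p : ℕ} (hp : (p : 𝒪) ≠ 0) (k : ℕ) :
    ((1 : PowerSeries 𝒪) + PowerSeries.X) ^ p ^ k - 1 ∈ (PowerSeries 𝒪)⁰ := by
  refine mem_nonZeroDivisors_of_ne_zero (one_add_X_pow_sub_one_ne_zero ?_)
  rw [Nat.cast_pow]
  exact pow_ne_zero k hp

/-- `ν_k = ∑_{i<p} (1+X)^{p^k i}` is a non-zero-divisor of `𝒪⟦X⟧` (`𝒪` a domain with `p ≠ 0`). [folklore] -/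
theorem geom_sum_one_add_X_pow_mem_nonZeroDivisors [IsDomain 𝒪] {p : ℕ} (hp : (p : 𝒪) ≠ 0) (k : ℕ) :
    (∑ i ∈ range p, ((1 : PowerSeries 𝒪) + PowerSeries.X) ^ (p ^ k * i)) ∈ (PowerSeries 𝒪)⁰ :=
  mem_nonZeroDivisors_of_ne_zero (geom_sum_one_add_X_pow_ne_zero hp)

end PowerSeriesModel

/-! ## §4 The family form (no inverse-limit object) -/

section Family

variable {R : Type*} [CommRing R]
variable (E : ℕ → Type*) [∀ k, AddCommGroup (E k)] [∀ k, Module R (E k)]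

/-- **Stub S2, family form.**  Under the hypotheses of `limit_torsionBy_eq_bot` (without any inverse-limit object): a family
`z k ∈ E k ⧸ R∙u k` which is norm-coherent (`N̄ k (z (k+1)) = z k` for the induced norms) and `ω n`-torsion at every level is
identically zero — «an `ω_n`-torsion coherent element is `2^{m'−m}`-divisible in the finite `B'_n`, hence `0`». [folklore] -/
theorem coherent_family_eq_zero
    (ω ν : ℕ → R) (c : R)
    (hω0 : ∀ k, ω k ∈ R⁰) (hν0 : ∀ k, ν k ∈ R⁰)
    (hων : ∀ k, ω (k + 1) = ν k * ω k)
    (hνc : ∀ k, ω k ∣ ν k - c)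
    (hdiv : ∀ n k, n ≤ k → ω n ∣ ω k)
    (hE : ∀ k (x : E k), ω k • x = 0)
    (j : ∀ k, E k →ₗ[R] E (k + 1)) (hj : ∀ k, Function.Injective (j k))
    (hjr : ∀ k (x : E (k + 1)), ω k • x = 0 → x ∈ LinearMap.range (j k))
    (Nm : ∀ k, E (k + 1) →ₗ[R] E k) (hNm : ∀ k (x : E (k + 1)), j k (Nm k x) = ν k • x)
    (u : ∀ k, E k) (hu : ∀ k (r : R), r • u k = 0 → ω k ∣ r)
    (hNu : ∀ k, Nm k (u (k + 1)) = u k)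
    (hjle : ∀ k, Submodule.span R {u k} ≤ (Submodule.span R {u (k + 1)}).comap (j k))
    (hNle : ∀ k, Submodule.span R {u (k + 1)} ≤ (Submodule.span R {u k}).comap (Nm k))
    (htors : ∀ k, ∃ e : ℕ, ∀ y : E k ⧸ Submodule.span R {u k}, c ^ e • y = 0)
    (n : ℕ) (z : ∀ k, E k ⧸ Submodule.span R {u k})
    (hz : ∀ k, Submodule.mapQ (Submodule.span R {u (k + 1)}) (Submodule.span R {u k}) (Nm k) (hNle k) (z (k + 1)) = z k)
    (hzω : ∀ k, ω n • z k = 0) :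
    ∀ k, z k = 0 := by
  have hun : ∀ k, j k (u k) = ν k • u (k + 1) := fun k => by rw [← hNu k, hNm]
  have hu' : ∀ k (r : R), r • u (k + 1) = 0 → ν k * ω k ∣ r := fun k r hr => by
    rw [← hων]; exact hu (k + 1) r hr
  have hjω : ∀ k (x : E k), ω k • j k x = 0 := fun k x => by rw [← map_smul, hE, map_zero]
  have hE' : ∀ k (x : E (k + 1)), (ν k * ω k) • x = 0 := fun k x => by
    rw [← hων]; exact hE (k + 1) x
  refine coherent_torsion_eq_zero (fun k => E k ⧸ Submodule.span R {u k}) c (ω n) n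
    (fun k => Submodule.mapQ _ _ (j k) (hjle k))
    (fun k => mapQ_injective_of_norm (hω0 k) (hu' k) (j k) (hj k) (hjω k) (hun k) (hjle k))
    (fun k => Submodule.mapQ _ _ (Nm k) (hNle k)) ?_ ?_ htors z hz hzω
  · intro k y
    obtain ⟨e, rfl⟩ := Submodule.mkQ_surjective _ y
    rw [Submodule.mkQ_apply, Submodule.mapQ_apply, Submodule.mapQ_apply,
      norm_comp_incl_eq_smul E ω ν c k (hνc k) (hE k) (j k) (hj k) (Nm k) (hNm k) e,
      Submodule.Quotient.mk_smul]
  · intro k hk w hw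
    rw [range_mapQ_eq_torsionBy_of_norm (hν0 k) (hE' k) (hu' k) (j k) (hjω k) (hjr k) (hjle k),
      Submodule.mem_torsionBy_iff]
    obtain ⟨r, hr⟩ := hdiv n k hk
    rw [hr, mul_comm, mul_smul, hw, smul_zero]

end Family

end Summit.BirchSwinnertonDyer.BirchSwinnertonDyer.Theorems.SignedMuAtTwo.NonsquareDescent
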